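import Mathlib.LinearAlgebra.Dimension.Finrank
import Mathlib.LinearAlgebra.Dimension.Constructions
import Mathlib.LinearAlgebra.Dimension.Free
import Mathlib.LinearAlgebra.Dimension.DivisionRing
import Mathlib.LinearAlgebra.Quotient.Basic
import Mathlib.Algebra.BigOperators.Group.Finset.Basic
import HarnessLib

/-!
# The Frölicher (first-page) rank inequality for a filtered space of cycles

The linear algebra behind the **Frölicher inequality** `b_k ≤ ∑_{p+q=k} h^{p,q}` (Voisin (2002),
§8.3.2–8.3.3): if `H = Z/B` is "cycles modulo boundaries" inside a vector space `V` carrying a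
finite decreasing filtration `F⁰ ⊇ F¹ ⊇ ⋯ ⊇ Fᴺ` with `Z ⊆ F⁰` and `Z ∩ Fᴺ ⊆ B`, then `H` carries
the induced filtration `Fᵖ H = Im (Z ∩ Fᵖ V → H)` (Voisin (2002), §8.3.1) and
`rank H = ∑_{p<N} rank Grᵖ_F H`.  The spectral-sequence mechanism bounding each graded piece by
"first-page data" is isolated here in the following hypothesis-light form: suppose that for each
level `p` there is a linear map `ψₚ : Z ∩ Fᵖ V → Eₚ` (in the geometric case: the Dolbeault class of
the leading `(p, k-p)`-component of a closed form) such that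

  (KEY) every `z ∈ Z ∩ Fᵖ V` with `ψₚ z = 0` is a boundary modulo `Fᵖ⁺¹`, i.e. `z - z' ∈ B` for
  some `z' ∈ Z ∩ Fᵖ⁺¹ V`.

Then `Grᵖ_F H` is a quotient of a subspace of `Eₚ` (namely of `range ψₚ`; this is the statement
"`E_∞^{p,q} = Fᵖ Hᵏ / Fᵖ⁺¹ Hᵏ` can be identified with a quotient of a subspace of `E₁^{p,q}`" of
Voisin (2002), Rem. 8.27, proof of Thm. 8.28, and Thm. 8.21 (iii)), whence

  `rank H ≤ ∑_{p<N} rank Eₚ`        (`Literature.LinearAlgebra.Filtration.rank_cyclesQuot_le_sum_rank`)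

as cardinals, with no finiteness hypothesis, and the `finrank` version
`Literature.LinearAlgebra.Filtration.finrank_cyclesQuot_le_sum_finrank` when the `Eₚ`, `p < N`, are
finite-dimensional (then `H` is finite-dimensional too,
`Literature.LinearAlgebra.Filtration.finite_cyclesQuot_of_finite`).  In the geometric application
(`Literature/AlgebraicGeometry/Motives/DeRhamComparisonProofs.lean`) `V = A^k(M)`, `Z`/`B` are the closed /
exact smooth complex `k`-forms, `Fᵖ` is the Hodge filtration by types `(r, k-r)`, `r ≥ p`,
`Eₚ = H^{p,k-p}_{∂̄}(M)` and (KEY) is the computation `d = ∂ + ∂̄` on pure types; finiteness of the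
`Eₚ` is Cartan–Serre.

## Main statements

* `Literature.LinearAlgebra.Filtration.cyclesFiltration Z B F p`: the induced filtration `Fᵖ H` on `H = Z/B`.
* `Literature.LinearAlgebra.Filtration.rank_eq_sum_rank_graded`: `rank H = ∑_{p<N} rank (Fᵖ H / Fᵖ⁺¹ H)` for a
  finite exhaustive separated decreasing filtration (Voisin (2002), §8.3.1–8.3.2).
* `Literature.LinearAlgebra.Filtration.lift_rank_graded_le_of_key` / `…rank_graded_le_rank_of_key`:
  under (KEY), `rank Grᵖ_F H ≤ rank Eₚ` (with `Cardinal.lift` for `Eₚ` in another universe).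
* `Literature.LinearAlgebra.Filtration.rank_cyclesQuot_le_sum_rank`, `…finrank_cyclesQuot_le_sum_finrank`:
  the Frölicher rank inequality, cardinal and natural-number forms.

## Design notes

* `H` is spelled `↥Z ⧸ B.comap Z.subtype` (no hypothesis `B ≤ Z`), which is *definitionally* the
  shape of `Literature.NumberTheory.Transcendental.complexDeRhamCohomology` and
  `Literature.NumberTheory.Transcendental.dolbeaultCohomology`; only `B ⊓ Z` matters.
* Everything is over a division ring `K`; the filtration is indexed by `ℕ` and assumed `Antitone`;
  the first-page spaces `E p` are an arbitrary family of `K`-modules and enter only through `ψ` and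
  (KEY), which is all the proof of Voisin's Thm. 8.21 (iii) uses in degree `k` (the one-piece
  bound `lift_rank_graded_le_of_key` allows `E` in any universe; the summed statements take the
  `E p` in the universe of `V`, so that ranks add without `Cardinal.lift`).
  Mathlib (pinned v4.32.0) has abstract spectral objects
  (`Mathlib.Algebra.Homology.SpectralObject.*`) but no numerical statement of this kind; the direct
  proof below is elementary linear algebra (`Submodule.rank_quotient_add_rank`,
  `LinearMap.rank_le_of_surjective`).
* Relation to the tree: `Literature.AlgebraicGeometry.Motives.gradedPiece F p`
  (`Literature/AlgebraicGeometry/Motives/DeRhamRealization.lean`) is the same quotient shape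
  `↥(F p) ⧸ (F (p+1)).comap (F p).subtype` for a `ℤ`-indexed filtration, and
  `Literature.AlgebraicGeometry.Motives.sum_finrank_gradedPiece_add_finrank` is the `finrank`
  telescoping `∑_{p<m} dim grᵖ + dim Fᵐ = dim V` under `[FiniteDimensional K V]`.  The present
  `rank_eq_sum_rank_graded` is the `ℕ`-indexed cardinal (`Module.rank`) version with no finiteness
  hypothesis — needed here because finiteness of `H` is a *conclusion*
  (`finite_cyclesQuot_of_finite`) — and the `finrank` identity follows from it by
  `Module.finrank_eq_rank` when the pieces are finite-dimensional; a librarian may later fold the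
  Motives copy into this file.

## References

* C. Voisin, *Hodge Theory and Complex Algebraic Geometry I* (2002), §8.3.1 (filtered complexes,
  `Fᵖ Hⁱ = Im(Hⁱ(Fᵖ A) → Hⁱ(A))`), Thm. 8.21 (iii), Rem. 8.27, Thm. 8.28 and Rem. 8.29, pp. 200–205
  (`VoisinHodgeI2002`).
* A. Frölicher, *Relations between the cohomology groups of Dolbeault and topological invariants*,
  Proc. Nat. Acad. Sci. USA 41 (1955), 641–644 (`FrolicherPNAS1955`).
-/

noncomputable section

open Module Cardinal

namespace Literature.LinearAlgebra.Filtration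

universe u v w

variable {K : Type u} [DivisionRing K] {V : Type v} [AddCommGroup V] [Module K V]

/-! ### The induced filtration on `H = Z / B` and its graded pieces -/

section Filtration

variable (Z B : Submodule K V) (F : ℕ → Submodule K V)

/-- The map `Z ∩ Fᵖ V → H = Z/B` sending a cycle of filtration level `≥ p` to its class
(Voisin (2002), §8.3.1). [cite: VoisinHodgeI2002, §8.3.1, p. 200] -/
def cyclesToQuot (p : ℕ) : ↥(Z ⊓ F p) →ₗ[K] (↥Z ⧸ B.comap Z.subtype) :=
  (B.comap Z.subtype).mkQ ∘ₗ Submodule.inclusion (inf_le_left : Z ⊓ F p ≤ Z)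

/-- The **induced filtration** `Fᵖ H = Im (Z ∩ Fᵖ V → H)` on `H = Z/B`
(Voisin (2002), §8.3.1: `Fᵖ Hⁱ(A) = Im (Hⁱ(Fᵖ A) → Hⁱ(A))`). [cite: VoisinHodgeI2002, §8.3.1, p. 200] -/
def cyclesFiltration (p : ℕ) : Submodule K (↥Z ⧸ B.comap Z.subtype) :=
  LinearMap.range (cyclesToQuot Z B F p)

/-- The graded piece `Grᵖ_F H = Fᵖ H / Fᵖ⁺¹ H` of the induced filtration (the abutment `E_∞^{p}`
of the spectral sequence, Voisin (2002), Thm. 8.21 (iii)). [cite: VoisinHodgeI2002, Thm. 8.21, p. 201] -/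
abbrev cyclesGraded (p : ℕ) : Type v :=
  ↥(cyclesFiltration Z B F p) ⧸
    (cyclesFiltration Z B F (p + 1)).comap (cyclesFiltration Z B F p).subtype

variable {Z B F}

/-- Unfolding `cyclesToQuot`: it is the class map on the underlying cycle. [folklore] -/
@[simp]
theorem cyclesToQuot_apply (p : ℕ) (z : ↥(Z ⊓ F p)) :
    cyclesToQuot Z B F p z = (B.comap Z.subtype).mkQ ⟨z, z.2.1⟩ :=
  rfl

/-- Two cycles have the same class in `H = Z/B` iff they differ by a boundary. [folklore] -/
theorem cyclesToQuot_eq_iff {p p' : ℕ} (z : ↥(Z ⊓ F p)) (z' : ↥(Z ⊓ F p')) :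
    cyclesToQuot Z B F p z = cyclesToQuot Z B F p' z' ↔ (z : V) - z' ∈ B := by
  rw [cyclesToQuot_apply, cyclesToQuot_apply, Submodule.mkQ_apply, Submodule.mkQ_apply,
    Submodule.Quotient.eq, Submodule.mem_comap]
  rfl

/-- The induced filtration is decreasing when `F` is. [folklore] -/
theorem cyclesFiltration_antitone (hF : Antitone F) : Antitone (cyclesFiltration Z B F) := by
  intro p p' hpp' x hx
  obtain ⟨z, rfl⟩ := hx
  exact ⟨⟨z, z.2.1, hF hpp' z.2.2⟩, rfl⟩

/-- The induced filtration is exhaustive: `F⁰ H = H` as soon as `Z ⊆ F⁰ V`. [folklore] -/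
theorem cyclesFiltration_zero (h0 : Z ≤ F 0) : cyclesFiltration Z B F 0 = ⊤ := by
  refine eq_top_iff.mpr fun x _ ↦ ?_
  obtain ⟨z, rfl⟩ := Submodule.mkQ_surjective _ x
  exact ⟨⟨z, z.2, h0 z.2⟩, rfl⟩

/-- The induced filtration is separated: `Fᴺ H = 0` as soon as `Z ∩ Fᴺ V ⊆ B`. [folklore] -/
theorem cyclesFiltration_eq_bot {N : ℕ} (hN : Z ⊓ F N ≤ B) : cyclesFiltration Z B F N = ⊥ := by
  refine eq_bot_iff.mpr fun x hx ↦ ?_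
  obtain ⟨z, rfl⟩ := hx
  rw [Submodule.mem_bot, cyclesToQuot_apply, Submodule.mkQ_apply, Submodule.Quotient.mk_eq_zero,
    Submodule.mem_comap]
  exact hN z.2

end Filtration

/-! ### Rank of a finitely filtered space -/

/-- **Rank is additive along a finite filtration**: if `G⁰ = H ⊇ G¹ ⊇ ⋯ ⊇ Gᴺ = 0` is a decreasing
chain of subspaces, then `rank H = ∑_{p<N} rank (Gᵖ / Gᵖ⁺¹)` (iterating
`rank (M/S) + rank S = rank M`; Voisin (2002), §8.3.2, the passage from `Gr_F H` to `H`).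
[cite: VoisinHodgeI2002, §8.3.2, pp. 201–202] -/
theorem rank_eq_sum_rank_graded {H : Type w} [AddCommGroup H] [Module K H]
    (G : ℕ → Submodule K H) (hG : Antitone G) (h0 : G 0 = ⊤) {N : ℕ} (hN : G N = ⊥) :
    Module.rank K H =
      ∑ p ∈ Finset.range N, Module.rank K (↥(G p) ⧸ (G (p + 1)).comap (G p).subtype) := by
  -- telescoping: `rank (G 0) = ∑_{p<n} rank Grᵖ + rank (G n)` for every `n`
  have key : ∀ n : ℕ, Module.rank K ↥(G 0) =
      ∑ p ∈ Finset.range n, Module.rank K (↥(G p) ⧸ (G (p + 1)).comap (G p).subtype) +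
        Module.rank K ↥(G n) := by
    intro n
    induction n with
    | zero => simp
    | succ n ih =>
      rw [Finset.sum_range_succ, ih, add_assoc]
      congr 1
      rw [← (Submodule.comapSubtypeEquivOfLe (hG (Nat.le_succ n))).rank_eq]
      exact (Submodule.rank_quotient_add_rank _).symm
  have h := key N
  rw [hN, h0, rank_top] at h
  rw [h]
  simp

/-! ### The first-page bound on a graded piece -/

section Key

variable {Z B : Submodule K V} {F : ℕ → Submodule K V}
  {E : Type w} [AddCommGroup E] [Module K E]

/-- The surjection `Z ∩ Fᵖ V ↠ Grᵖ_F H` (class in `Fᵖ H`, then modulo `Fᵖ⁺¹ H`). [folklore] -/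
def cyclesToGraded (Z B : Submodule K V) (F : ℕ → Submodule K V) (p : ℕ) :
    ↥(Z ⊓ F p) →ₗ[K] cyclesGraded Z B F p :=
  ((cyclesFiltration Z B F (p + 1)).comap (cyclesFiltration Z B F p).subtype).mkQ ∘ₗ
    (cyclesToQuot Z B F p).rangeRestrict

/-- `cyclesToGraded` is surjective (both factors are). [folklore] -/
theorem cyclesToGraded_surjective (p : ℕ) : Function.Surjective (cyclesToGraded Z B F p) :=
  (Submodule.mkQ_surjective _).comp (LinearMap.surjective_rangeRestrict _)

/-- Under **(KEY)** — a cycle of level `p` killed by `ψ` is a boundary modulo level `p + 1` — the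
kernel of `ψ` dies in `Grᵖ_F H` (Voisin (2002), proof of Thm. 8.21 (iii): `E_∞` is computed from
`E₁` by passing to subquotients). [cite: VoisinHodgeI2002, Thm. 8.21, pp. 201–202] -/
theorem ker_le_ker_cyclesToGraded {p : ℕ} (ψ : ↥(Z ⊓ F p) →ₗ[K] E)
    (hkey : ∀ z : ↥(Z ⊓ F p), ψ z = 0 → ∃ z' ∈ Z ⊓ F (p + 1), (z : V) - z' ∈ B) :
    LinearMap.ker ψ ≤ LinearMap.ker (cyclesToGraded Z B F p) := by
  intro z hz
  obtain ⟨z', hz', hzz'⟩ := hkey z hz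
  rw [LinearMap.mem_ker, cyclesToGraded, LinearMap.comp_apply, Submodule.mkQ_apply,
    Submodule.Quotient.mk_eq_zero, Submodule.mem_comap, Submodule.subtype_apply]
  refine ⟨⟨z', hz'⟩, ?_⟩
  change cyclesToQuot Z B F (p + 1) ⟨z', hz'⟩ = cyclesToQuot Z B F p z
  exact ((cyclesToQuot_eq_iff z ⟨z', hz'⟩).mpr hzz').symm

/-- **`E_∞ᵖ` is a quotient of a subspace of `E₁ᵖ`** (Voisin (2002), Rem. 8.27 and Thm. 8.21 (iii)):
under (KEY) the graded piece `Grᵖ_F H` is a quotient of `range ψ ⊆ E`, so `rank Grᵖ_F H ≤ rank E`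
(`dim E_∞^{p,q} ≤ dim E_1^{p,q}`, proof of Thm. 8.28).  Universe-general form, with `E` in any
universe and the ranks compared through `Cardinal.lift`. [cite: VoisinHodgeI2002, Rem. 8.27, p. 204] -/
theorem lift_rank_graded_le_of_key {p : ℕ} (ψ : ↥(Z ⊓ F p) →ₗ[K] E)
    (hkey : ∀ z : ↥(Z ⊓ F p), ψ z = 0 → ∃ z' ∈ Z ⊓ F (p + 1), (z : V) - z' ∈ B) :
    Cardinal.lift.{w} (Module.rank K (cyclesGraded Z B F p)) ≤
      Cardinal.lift.{v} (Module.rank K E) := by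
  -- factor the surjection `Z ∩ Fᵖ ↠ Grᵖ` through `Z ∩ Fᵖ / ker ψ ≃ range ψ`
  let Θ : (↥(Z ⊓ F p) ⧸ LinearMap.ker ψ) →ₗ[K] cyclesGraded Z B F p :=
    (LinearMap.ker ψ).liftQ (cyclesToGraded Z B F p) (ker_le_ker_cyclesToGraded ψ hkey)
  have hΘ : Function.Surjective
      (Θ ∘ₗ (ψ.quotKerEquivRange.symm : ↥(LinearMap.range ψ) →ₗ[K] _)) := by
    rw [LinearMap.coe_comp]
    refine Function.Surjective.comp ?_ ψ.quotKerEquivRange.symm.surjective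
    intro x
    obtain ⟨z, rfl⟩ := cyclesToGraded_surjective p x
    exact ⟨Submodule.Quotient.mk z, rfl⟩
  calc Cardinal.lift.{w} (Module.rank K (cyclesGraded Z B F p))
      ≤ Cardinal.lift.{v} (Module.rank K ↥(LinearMap.range ψ)) :=
        LinearMap.lift_rank_le_of_surjective _ hΘ
    _ ≤ Cardinal.lift.{v} (Module.rank K E) := Cardinal.lift_le.mpr (Submodule.rank_le _)

end Key

section KeySameUniverse

variable {Z B : Submodule K V} {F : ℕ → Submodule K V}
  {E : Type v} [AddCommGroup E] [Module K E]

/-- Under (KEY), `rank Grᵖ_F H ≤ rank E` (`dim E_∞^{p,q} ≤ dim E_1^{p,q}`, Voisin (2002), proof of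
Thm. 8.28), for `E` in the universe of `V` (from `lift_rank_graded_le_of_key`).
[cite: VoisinHodgeI2002, Thm. 8.28, p. 205] -/
theorem rank_graded_le_rank_of_key {p : ℕ} (ψ : ↥(Z ⊓ F p) →ₗ[K] E)
    (hkey : ∀ z : ↥(Z ⊓ F p), ψ z = 0 → ∃ z' ∈ Z ⊓ F (p + 1), (z : V) - z' ∈ B) :
    Module.rank K (cyclesGraded Z B F p) ≤ Module.rank K E := by
  simpa only [Cardinal.lift_id] using lift_rank_graded_le_of_key ψ hkey

end KeySameUniverse


/-! ### The Frölicher rank inequality -/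

section Main

variable {Z B : Submodule K V} {F : ℕ → Submodule K V} {N : ℕ}
  {E : ℕ → Type v} [∀ p, AddCommGroup (E p)] [∀ p, Module K (E p)]

/-- **Frölicher rank inequality, cardinal form.** Let `H = Z/B` with `Z, B ⊆ V`, let
`F⁰ ⊇ F¹ ⊇ ⋯` be a decreasing filtration of `V` with `Z ⊆ F⁰` and `Z ∩ Fᴺ ⊆ B`, and let
`ψₚ : Z ∩ Fᵖ → Eₚ` (`p < N`) be linear maps satisfying (KEY): `ψₚ z = 0` implies `z - z' ∈ B` for
some `z' ∈ Z ∩ Fᵖ⁺¹`.  Then `rank H ≤ ∑_{p<N} rank Eₚ`: `rank H = ∑ rank Grᵖ_F H` and each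
`Grᵖ_F H = E_∞ᵖ` is a subquotient of `Eₚ = E₁ᵖ`.  This is the numerical content of Voisin (2002),
Thm. 8.21 (iii) with Rem. 8.27 and the proof of Thm. 8.28 (`dim E_∞^{p,q} ≤ dim E_1^{p,q}`,
summed over `p + q = k`), isolated from the de Rham complex; no finiteness is assumed.
[cite: VoisinHodgeI2002, Thm. 8.28 and Rem. 8.27, pp. 204–205] -/
theorem rank_cyclesQuot_le_sum_rank (hF : Antitone F) (h0 : Z ≤ F 0) (hN : Z ⊓ F N ≤ B)
    (ψ : ∀ p, ↥(Z ⊓ F p) →ₗ[K] E p)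
    (hkey : ∀ p < N, ∀ z : ↥(Z ⊓ F p), ψ p z = 0 → ∃ z' ∈ Z ⊓ F (p + 1), (z : V) - z' ∈ B) :
    Module.rank K (↥Z ⧸ B.comap Z.subtype) ≤ ∑ p ∈ Finset.range N, Module.rank K (E p) := by
  rw [rank_eq_sum_rank_graded (cyclesFiltration Z B F) (cyclesFiltration_antitone hF)
    (cyclesFiltration_zero h0) (cyclesFiltration_eq_bot hN)]
  exact Finset.sum_le_sum fun p hp ↦
    rank_graded_le_rank_of_key (ψ p) (hkey p (Finset.mem_range.mp hp))

/-- With finite-dimensional first pages the sum of ranks is the natural number `∑ finrank Eₚ`.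
[folklore] -/
theorem sum_rank_eq_natCast_sum_finrank (hfin : ∀ p < N, Module.Finite K (E p)) :
    ∑ p ∈ Finset.range N, Module.rank K (E p) =
      ((∑ p ∈ Finset.range N, Module.finrank K (E p) : ℕ) : Cardinal) := by
  rw [Nat.cast_sum]
  refine Finset.sum_congr rfl fun p hp ↦ ?_
  haveI := hfin p (Finset.mem_range.mp hp)
  exact (Module.finrank_eq_rank K (E p)).symm

/-- Under the hypotheses of `rank_cyclesQuot_le_sum_rank`, if the first-page spaces `Eₚ`
(`p < N`) are finite-dimensional then so is `H = Z/B` (finiteness of the abutment from finiteness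
of `E₁`; in the geometric case: finiteness of de Rham cohomology of a compact complex manifold from
Cartan–Serre). [cite: VoisinHodgeI2002, Thm. 8.28 and Rem. 8.29, p. 205] -/
theorem finite_cyclesQuot_of_finite (hF : Antitone F) (h0 : Z ≤ F 0) (hN : Z ⊓ F N ≤ B)
    (ψ : ∀ p, ↥(Z ⊓ F p) →ₗ[K] E p)
    (hkey : ∀ p < N, ∀ z : ↥(Z ⊓ F p), ψ p z = 0 → ∃ z' ∈ Z ⊓ F (p + 1), (z : V) - z' ∈ B)
    (hfin : ∀ p < N, Module.Finite K (E p)) :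
    Module.Finite K (↥Z ⧸ B.comap Z.subtype) := by
  rw [← Module.rank_lt_aleph0_iff]
  refine (rank_cyclesQuot_le_sum_rank hF h0 hN ψ hkey).trans_lt ?_
  rw [sum_rank_eq_natCast_sum_finrank hfin]
  exact Cardinal.natCast_lt_aleph0

/-- **Frölicher rank inequality, `finrank` form** (`b ≤ ∑ h^{p}`): under the hypotheses of
`rank_cyclesQuot_le_sum_rank` and finite-dimensionality of the first pages `Eₚ` (`p < N`),
`dim H ≤ ∑_{p<N} dim Eₚ` (Voisin (2002), proof of Thm. 8.28 and Rem. 8.29: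
`b_k ≤ ∑_{p+q=k} h^{p,q}`, with equality iff degeneration at `E₁`).
[cite: VoisinHodgeI2002, Thm. 8.28 and Rem. 8.29, p. 205] -/
theorem finrank_cyclesQuot_le_sum_finrank (hF : Antitone F) (h0 : Z ≤ F 0) (hN : Z ⊓ F N ≤ B)
    (ψ : ∀ p, ↥(Z ⊓ F p) →ₗ[K] E p)
    (hkey : ∀ p < N, ∀ z : ↥(Z ⊓ F p), ψ p z = 0 → ∃ z' ∈ Z ⊓ F (p + 1), (z : V) - z' ∈ B)
    (hfin : ∀ p < N, Module.Finite K (E p)) :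
    Module.finrank K (↥Z ⧸ B.comap Z.subtype) ≤ ∑ p ∈ Finset.range N, Module.finrank K (E p) := by
  haveI := finite_cyclesQuot_of_finite hF h0 hN ψ hkey hfin
  have h := rank_cyclesQuot_le_sum_rank hF h0 hN ψ hkey
  rw [sum_rank_eq_natCast_sum_finrank hfin, ← Module.finrank_eq_rank] at h
  exact_mod_cast h

end Main

end Literature.LinearAlgebra.Filtration
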